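import Summits.BirchSwinnertonDyer.BirchSwinnertonDyer.Theorems.ClassRecordThreeEulerHalvesAtThreeCartanCoverPrintClausesSurjectiveDivision
import HarnessLib

/-!
# The torsion-refined Shapiro count, part N: THE GROUP-THEORETIC BRICKS OF THE KERNEL-COVER TOWER — finite order of elements of `ι(O¹)` with a fixed
# point, torsion-null cochains kill them, freeness of `Γ ∕ ker ψ` downstairs, and the torsion-free normal cocompact level INSIDE `ker ψ`

Helper file (route `ClassRecordThree`, crux `EulerHalvesAtThree` item 19109 → node `CartanOnePlaceDegreeLawAtThree` item 24801, print residue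
(SIGᶜ-lift)(ii) = conjunct 4 `htors` of the keyed line `Lines/petarea.lean` rev 5; seat bsd-idea-10 g25, lens transfer, `--supports
stmt-BirchSwinnertonDyer-19109 --as helper`). Part M (`…TorsionCountM`) reduced `htors` to a KERNEL-COVER TOWER `ℍ → ker ψ∖ℍ → Γ∖ℍ` per torsion-null
additive cochain `ψ : Γ = ι(O¹) → ZMod n` at a division algebra, listing four bricks (T-a)–(T-d). This file proves the two bricks that are NUMBER ∕ GROUP
THEORY — (T-a) and the set-theoretic core of (T-c) — for EVERY order `O` of EVERY indefinite division quaternion algebra `B` and every injective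
`ι : B →ₐ[ℚ] M₂(ℝ)`, from the LEAD's torsion-free normal level `exists_torsionFree_level_subgroup` (`…CartanCoverPrintClausesSurjectiveDivision`, Minkowski at
the odd prime `3` + Jordan–Zassenhaus + cocompactness) and finiteness of stabilisers (`CartanCover.PrintClauses.finite_stabilizer`):

* `isOfFinOrder_of_smul_eq` — **an element of `ι(O¹)` fixing a point of `ℍ` has finite order** (if `Γ' ⊴ Γ` is the torsion-free level of index `m`, then
  `γ^m ∈ Γ'` fixes the point, lies in the finite stabiliser `Γ'_z`, hence is torsion, hence `γ^m = 1`); [Shimura Prop. 1.16: stabilisers of a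
  Fuchsian group are finite cyclic; Katok Thm. 2.2.3 ∕ Cor. 2.2.7]
* `eq_zero_of_smul_eq` — a TORSION-NULL cochain `ψ` vanishes on every element with a fixed point;
* `eq_zero_of_smul_eq_smul` — **freeness downstairs**: if `ψ` is additive and torsion-null, `ψ k = 0` and `k • z = γ • z`, then `ψ γ = 0`; i.e. the
  finite group `Γ ∕ ker ψ` acts FREELY on `ker ψ∖ℍ` (the covering `ker ψ∖ℍ → Γ∖ℍ` is unramified — brick (T-c) of part M as a statement about `Γ`, `ψ`, `ℍ`);
* `exists_torsionFree_level_subgroup_le_ker` — **brick (T-a)**: for `n ≠ 0` and `ψ` additive there is `Γ' ≤ ι(O¹)` INSIDE `ker ψ`, normal and of finite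
  index in `ι(O¹)`, properly discontinuous on `ℍ`, torsion-free and cocompact (the LEAD's level intersected with `ker ψ`, which is normal of finite
  index because `ZMod n` is finite; cocompactness spread over coset representatives by the LEAD's `exists_isCompact_reps_of_finset_leftCosets`).

What this leaves of the tower (bricks (T-b), (T-d) and the covering half of (T-c) of part M): the compact Riemann surfaces `S = Γ'∖ℍ` (in tree for such
`Γ'`: `CartanCover.PrintClauses.isManifold_orbitQuotient`, `compactSpace_orbitQuotient_of_reps`), `X = Γ∖ℍ` and `Y = ker ψ∖ℍ` as orbit surfaces of the
finite group `Γ ∕ Γ'` acting holomorphically on `S` (`Literature.Geometry.Kaehler.RiemannSurfaceQuotient*`, `Literature.Geometry.Manifold.QuotientDeck`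
for the descended action), and Mathlib's `IsQuotientMap.isQuotientCoveringMap_of_properlyDiscontinuousSMul` for `Y → X`, whose freeness
hypothesis `IsCancelSMul` is exactly `eq_zero_of_smul_eq_smul`. Theorems only: no definition, no instance, no notation, no named fact, no `sorry`.
Nothing about NUM, (M), (KTYPE), (PET) or any curve is proved; no summit statement is proved; BSD is proved for no curve.

## References
* G. Shimura, *Introduction to the Arithmetic Theory of Automorphic Functions* (1971), §1.2 Prop. 1.16–1.17 (stabilisers in a Fuchsian group are
  finite), §9.2 p. 246 (unit groups of orders in indefinite division quaternion algebras are cocompact Fuchsian groups). [ShimuraIATAF1971]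
* S. Katok, *Fuchsian Groups*, Univ. of Chicago Press (1992), Thm. 2.2.3, Cor. 2.2.7 (properly discontinuous ⇔ discrete; finite stabilisers),
  §4.1–4.2 (arithmetic Fuchsian groups from quaternion algebras). [Katok1992]
* M.-F. Vignéras, *Arithmétique des algèbres de quaternions*, LNM 800 (1980), Ch. IV §1 Thm. 1.1 p. 104. [VignerasLNM800]
* A. Hatcher, *Algebraic Topology* (2002), Prop. 1.40 p. 72 (free actions and quotient coverings). [HatcherAT2002]
-/

set_option linter.dupNamespace false
set_option autoImplicit false

noncomputable section

open scoped MatrixGroups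
open Function Set

namespace Summit.BirchSwinnertonDyer.BirchSwinnertonDyer.Theorems.EichlerShimuraLevelN

open Literature.NumberTheory.Automorphic
open Summit.BirchSwinnertonDyer.BirchSwinnertonDyer.Theorems.CartanCover.PrintClauses

variable {B : Type*} [Ring B] [Algebra ℚ B] [IsQuaternionAlgebra ℚ B] (ι : B →ₐ[ℚ] Matrix (Fin 2) (Fin 2) ℝ)
  {O : Submodule ℤ B} (hO : Brandt.IsOrder B O)

/-- **An element of `ι(O¹)` (`B` a division algebra) with a fixed point in `ℍ` has finite order**: with `Γ' ⊴ Γ` the torsion-free normal level of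
index `m` (`exists_torsionFree_level_subgroup`), `γ^m ∈ Γ'` fixes the point, so lies in the finite stabiliser `Γ'_z`, so is torsion, so `γ^m = 1`.
[cite: ShimuraIATAF1971, §1.2 Prop. 1.16 and §9.2 p. 246] [cite: Katok1992, Thm. 2.2.3 and Cor. 2.2.7] -/
theorem isOfFinOrder_of_smul_eq (hι : Function.Injective ι) (hdiv : ∀ x : B, x ≠ 0 → IsUnit x)
    (γ : normOneUnits ι hO) {z : UpperHalfPlane} (hz : γ • z = z) : IsOfFinOrder γ := by
  obtain ⟨Γ', hle, hN, hfi, hpd, htf, -⟩ := exists_torsionFree_level_subgroup ι hO hι hdiv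
  haveI := hN; haveI := hfi; haveI := hpd
  set H := Γ'.subgroupOf (normOneUnits ι hO) with hH
  have hm : 0 < H.index := Nat.pos_of_ne_zero Subgroup.FiniteIndex.index_ne_zero
  have hmem : γ ^ H.index ∈ H := Subgroup.pow_index_mem H γ
  -- the element `γ ^ m` of `Γ'` fixes `z`
  have hmem' : ((γ ^ H.index : normOneUnits ι hO) : GL (Fin 2) ℝ) ∈ Γ' := by
    simpa [H, Subgroup.mem_subgroupOf] using hmem
  set g' : Γ' := ⟨((γ ^ H.index : normOneUnits ι hO) : GL (Fin 2) ℝ), hmem'⟩ with hg'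
  have hfix : g' • z = z := by
    have h1 : (γ ^ H.index) • z = z := by
      have := (MulAction.stabilizer (normOneUnits ι hO) z).pow_mem (MulAction.mem_stabilizer_iff.mpr hz) H.index
      exact MulAction.mem_stabilizer_iff.mp this
    exact h1
  -- stabilisers in `Γ'` are finite, so `g'` has finite order, so `g' = 1`
  have hfin : (MulAction.stabilizer Γ' z : Set Γ').Finite := finite_stabilizer Γ' z
  have hg'fin : IsOfFinOrder g' := by
    haveI : Finite (MulAction.stabilizer Γ' z) := hfin.to_subtype
    have h2 : IsOfFinOrder (⟨g', MulAction.mem_stabilizer_iff.mpr hfix⟩ : MulAction.stabilizer Γ' z) := isOfFinOrder_of_finite _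
    exact (MulAction.stabilizer Γ' z).subtype.isOfFinOrder h2
  have hg'1 : g' = 1 := htf g' hg'fin
  have hpow : γ ^ H.index = 1 := by
    apply Subtype.ext
    have := congrArg (fun x : Γ' => (x : GL (Fin 2) ℝ)) hg'1
    simpa [g'] using this
  exact isOfFinOrder_iff_pow_eq_one.mpr ⟨H.index, hm, hpow⟩

/-- **A torsion-null cochain vanishes on every element with a fixed point.** [cite: ShimuraIATAF1971, §1.2 Prop. 1.16 and §8.2 (8.2.6) p. 232] -/
theorem eq_zero_of_smul_eq (hι : Function.Injective ι) (hdiv : ∀ x : B, x ≠ 0 → IsUnit x) {n : ℕ}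
    (ψ : normOneUnits ι hO → ZMod n) (htor : ∀ γ : normOneUnits ι hO, IsOfFinOrder γ → ψ γ = 0)
    (γ : normOneUnits ι hO) {z : UpperHalfPlane} (hz : γ • z = z) : ψ γ = 0 :=
  htor γ (isOfFinOrder_of_smul_eq ι hO hι hdiv γ hz)

/-- **Freeness downstairs (the unramified half of brick (T-c)).** For `ψ` additive and torsion-null: if `ψ k = 0` and `k • z = γ • z` then `ψ γ = 0` —
`k⁻¹γ` fixes `z`. Equivalently the finite group `Γ ∕ ker ψ` acts freely on `ker ψ∖ℍ`, so `ker ψ∖ℍ → Γ∖ℍ` is an unramified Galois covering.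
[cite: HatcherAT2002, Prop. 1.40 p. 72] [cite: ShimuraIATAF1971, §1.2 Prop. 1.16] -/
theorem eq_zero_of_smul_eq_smul (hι : Function.Injective ι) (hdiv : ∀ x : B, x ≠ 0 → IsUnit x) {n : ℕ}
    (ψ : normOneUnits ι hO → ZMod n) (hadd : ∀ γ δ : normOneUnits ι hO, ψ (γ * δ) = ψ γ + ψ δ)
    (htor : ∀ γ : normOneUnits ι hO, IsOfFinOrder γ → ψ γ = 0)
    (γ k : normOneUnits ι hO) (hk : ψ k = 0) {z : UpperHalfPlane} (hz : k • z = γ • z) : ψ γ = 0 := by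
  have hfix : (k⁻¹ * γ) • z = z := by rw [mul_smul, ← hz, inv_smul_smul]
  have h0 := eq_zero_of_smul_eq ι hO hι hdiv ψ htor (k⁻¹ * γ) hfix
  have : ψ γ = ψ k + ψ (k⁻¹ * γ) := by rw [← hadd, mul_inv_cancel_left]
  rw [this, hk, h0, add_zero]

/-- **BRICK (T-a): THE TORSION-FREE NORMAL COCOMPACT LEVEL INSIDE `ker ψ`.** For `B` a division algebra, `ι` injective, `n ≠ 0` and `ψ : ι(O¹) → ZMod n`
additive there is `Γ' ≤ ι(O¹)` with `ψ = 0` on `Γ'`, normal and of finite index in `ι(O¹)`, properly discontinuous on `ℍ`, torsion-free and cocompact: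
the LEAD's level `exists_torsionFree_level_subgroup` intersected with `ker ψ` (normal of finite index since `ZMod n` is finite), cocompactness spread
over coset representatives (`exists_isCompact_reps_of_finset_leftCosets`). [cite: VignerasLNM800, Ch. IV §1 Thm. 1.1 p. 104]
[cite: ShimuraIATAF1971, §9.2 p. 246 and §1.3 Prop. 1.31] [cite: Katok1992, §4.1] -/
theorem exists_torsionFree_level_subgroup_le_ker (hι : Function.Injective ι) (hdiv : ∀ x : B, x ≠ 0 → IsUnit x)
    {n : ℕ} (hn : n ≠ 0) (ψ : normOneUnits ι hO → ZMod n) (hadd : ∀ γ δ : normOneUnits ι hO, ψ (γ * δ) = ψ γ + ψ δ) :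
    ∃ Γ' : Subgroup (GL (Fin 2) ℝ), Γ' ≤ normOneUnits ι hO ∧
      (∀ γ : normOneUnits ι hO, (γ : GL (Fin 2) ℝ) ∈ Γ' → ψ γ = 0) ∧
      (Γ'.subgroupOf (normOneUnits ι hO)).Normal ∧
      (Γ'.subgroupOf (normOneUnits ι hO)).FiniteIndex ∧ ProperlyDiscontinuousSMul Γ' UpperHalfPlane ∧
      (∀ γ : Γ', IsOfFinOrder γ → γ = 1) ∧ ∃ K : Set UpperHalfPlane, IsCompact K ∧ ∀ z : UpperHalfPlane, ∃ γ ∈ Γ', γ • z ∈ K := by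
  classical
  obtain ⟨Γ₁, hle, hN, hfi, hpd, htf, K, hK, hcov⟩ := exists_torsionFree_level_subgroup ι hO hι hdiv
  haveI := hN; haveI := hfi; haveI := hpd
  haveI : NeZero n := ⟨hn⟩
  -- the kernel of `ψ` as a subgroup of `Γ = ι(O¹)`
  have hψ1 : ψ 1 = 0 := by have h := hadd 1 1; rw [mul_one] at h; exact left_eq_add.mp h
  let ψhom : normOneUnits ι hO →* Multiplicative (ZMod n) :=
    { toFun := fun γ => Multiplicative.ofAdd (ψ γ), map_one' := by simp [hψ1], map_mul' := fun γ δ => by simp [hadd, ofAdd_add] }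
  let Kψ : Subgroup (normOneUnits ι hO) := ψhom.ker
  haveI : Kψ.Normal := inferInstance
  haveI : Kψ.FiniteIndex := by
    haveI : Finite (normOneUnits ι hO ⧸ Kψ) := Finite.of_equiv _ (QuotientGroup.quotientKerEquivRange ψhom).symm.toEquiv
    exact Subgroup.finiteIndex_of_finite_quotient
  have hKψ : ∀ γ : normOneUnits ι hO, γ ∈ Kψ ↔ ψ γ = 0 := fun γ => by
    simp [Kψ, MonoidHom.mem_ker, ψhom]
  -- the level: `Γ' = Γ₁ ⊓ Kψ`
  let Γ' : Subgroup (GL (Fin 2) ℝ) := Γ₁ ⊓ Kψ.map (normOneUnits ι hO).subtype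
  have hΓ'le : Γ' ≤ Γ₁ := inf_le_left
  have hsub : Γ'.subgroupOf (normOneUnits ι hO) = Γ₁.subgroupOf (normOneUnits ι hO) ⊓ Kψ := by
    ext γ
    simp only [Γ', Subgroup.mem_subgroupOf, Subgroup.mem_inf, Subgroup.mem_map, Subgroup.coe_subtype]
    constructor
    · rintro ⟨h1, k, hk, hkγ⟩
      exact ⟨h1, by rwa [← Subtype.ext hkγ]⟩
    · rintro ⟨h1, h2⟩
      exact ⟨h1, γ, h2, rfl⟩
  refine ⟨Γ', hΓ'le.trans hle, fun γ hγ => ?_, ?_, ?_, ?_, fun γ hγ => ?_, ?_⟩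
  · -- inside the kernel
    have : γ ∈ Γ'.subgroupOf (normOneUnits ι hO) := Subgroup.mem_subgroupOf.mpr hγ
    rw [hsub] at this
    exact (hKψ γ).mp this.2
  · rw [hsub]; infer_instance
  · rw [hsub]; infer_instance
  · -- properly discontinuous: a subgroup of `Γ₁`
    refine ⟨fun {K₀ L₀} hK₀ hL₀ => ?_⟩
    have h₁ := hpd.finite_disjoint_inter_image hK₀ hL₀
    refine (h₁.preimage (Subgroup.inclusion_injective hΓ'le).injOn).subset ?_
    intro γ hγ
    exact hγ
  · -- torsion-free
    have h := htf (Subgroup.inclusion hΓ'le γ) ((Subgroup.inclusion hΓ'le).isOfFinOrder hγ)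
    exact Subgroup.inclusion_injective hΓ'le (by rw [h, map_one])
  · -- cocompact: spread `K` over coset representatives of `Γ'` in `Γ`
    let H := Γ'.subgroupOf (normOneUnits ι hO)
    haveI : H.FiniteIndex := by rw [show H = _ from hsub]; infer_instance
    haveI : Finite (normOneUnits ι hO ⧸ H) := Subgroup.finite_quotient_of_finiteIndex
    letI : Fintype (normOneUnits ι hO ⧸ H) := Fintype.ofFinite _
    let T : Finset (GL (Fin 2) ℝ) := (Finset.univ : Finset (normOneUnits ι hO ⧸ H)).image fun q => ((Quotient.out q : normOneUnits ι hO) : GL (Fin 2) ℝ)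
    refine exists_isCompact_reps_of_finset_leftCosets hK hcov T fun γ hγ => ?_
    let g : normOneUnits ι hO := ⟨γ, hle hγ⟩
    refine ⟨((Quotient.out (QuotientGroup.mk (s := H) g) : normOneUnits ι hO) : GL (Fin 2) ℝ), Finset.mem_image.mpr ⟨_, Finset.mem_univ _, rfl⟩, ?_⟩
    have hq : (Quotient.out (QuotientGroup.mk (s := H) g))⁻¹ * g ∈ H :=
      QuotientGroup.eq.mp (QuotientGroup.out_eq' (QuotientGroup.mk (s := H) g))
    exact Subgroup.mem_subgroupOf.mp hq

end Summit.BirchSwinnertonDyer.BirchSwinnertonDyer.Theorems.EichlerShimuraLevelN
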